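import Literature.AlgebraicGeometry.AbelianSchemes.AbelianSchemeKOfLFlat
import Literature.AlgebraicGeometry.AbelianSchemes.AbelianSchemeOverMulNEtale
import HarnessLib

/-!
# `K(L) → S` is FINITE ÉTALE over ANY Noetherian affine base on which an exponent killing `K(L)` is invertible
# (Mumford, *Abelian Varieties* §13 / §23; MFK Prop. 6.13 (iii); the (K) road of ★ `AbelianSchemeKOfLFlat` taken OFF `ℚ`)

Layer `Literature/AlgebraicGeometry/AbelianSchemes`, namespace `Literature.AlgebraicGeometry.AbelianSchemes.AbelianSchemeOver`.
Cell `hodgecm-mathlib` (D-0151), P6 «MOD programme», deal (s2-D) «DUAL PAIR AT GOOD PRIMES» road (A), organ (K′) (LEAD F0P6-plan (g2)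
2026-09-01T22:04:19Z / M-25 22:14:53Z; prover seat B-p04 (g39)).  THEOREMS ONLY (no definition, no instance, no named fact, no `sorry`);
NEW statements — the ★ files `AbelianSchemeKOfLFlat` / `AbelianSchemeKOfLUnramified` are untouched.

WHAT CHANGES.  ★ `AbelianSchemeKOfLFlat.exists_kOfL_etale` proves «`K(L)` finite étale» over a Noetherian `ℚ`-ALGEBRA `R`; the hypothesis
`[Algebra ℚ R]` enters at exactly two places: (U) the fibres `K(L)_t` at field points are étale because the order of `K(L)_t` is non-zero in a
field of characteristic `0` (★ `etale_pullback_obj_hom`), and (T) TORSION RIGIDITY in the core ★ `exists_infinitesimal_fac_of_pow_eq_one`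
needs the killing exponent `n` to be a UNIT of `Γ(A ×_R T, 𝒪)` (★ `isUnit_natCast_Γ`).  Both only need: an exponent `n` with
`K(L) ⊆ A[n]` (every `u ∈ K(L)(T)` has `u ^ n = 1`) which is INVERTIBLE IN `R`.  This file re-runs the (K) road under exactly that
hypothesis, in every characteristic:
* §1 `isUnit_natCast_Γ_of_isUnit`, `natCast_ne_zero_of_isUnit_specMap` — `n ∈ R^× ⇒ n ∈ Γ(X, 𝒪_X)^×` for every `X → Spec R`, and
  `n ≠ 0` in every field receiving `R`;
* §2 `etale_pullback_obj_hom_of_pow_eq_one`, **`formallyUnramified_hom_of_pow_eq_one_of_isUnit`** — a closed subscheme `i : Z ↪ A`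
  finite over `Spec R` with `i ^ n = 1`, `n ∈ R^×`, has ÉTALE fibres at field points (★ U2 `etale_hom_of_pow_eq_one`) hence is FORMALLY
  UNRAMIFIED over `Spec R` (★ `formallyUnramified_left_of_forall_exists_fieldPoint`), and ÉTALE once flat;
* §3 **`isOpenImmersion_left_of_pow_eq_one_of_isUnit`** — THE CORE of road (T) verbatim, with `n ∈ R^×` in place of `[Algebra ℚ R]`:
  the representing `Z ↪ A[n]` is an OPEN immersion;
* §4 **`flat_hom_of_iff_memKOfL_of_isUnit`**, HEAD **`exists_kOfL_etale_of_isUnit`** — for every abelian scheme `A` over a Noetherian ring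
  `R`, every rank-one `L` on `A` rigidified along the unit section and fibrewise of the class of an ample divisor, and every `n ∈ R^×` with
  `u ^ n = 1` for all `u ∈ K(L)(T)`: `K(L)` is represented by a closed subgroup scheme `i : Z ↪ A` FINITE ÉTALE over `Spec R` with
  `i ^ n = 1` — the conclusion of ★ `exists_kOfL_etale` plus the exponent.  Over a `ℚ`-algebra the extra hypothesis is free (★ `exists_pow_eq_one_of_formallyUnramified`
  + ★ `isUnit_natCast_Γ`), so this is a strict generalisation of the ★ head.
WHAT IS NOT HERE (said, not attempted): the DISCHARGE of «`K(L) ⊆ A[n]`, `n ∈ R^×`» at points of positive characteristic.  In print it is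
«`|K(L_s̄)| = χ(L_s)²` is locally constant» ([MumfordAV1970] §16 Riemann–Roch, §23) or «`Λ(L) : A → Â` is finite flat» ([MumfordFogartyKirwan1994]
Prop. 6.13 (iii)); the tree holds the first only in characteristic `0` (★ `Motives/AbelianVarietyH0SqEqCardKThetaAnyField`, by transport from
`ℂ`).  HC_CM is proved only modulo the 2 remaining named inputs (hLiu418, h413); this file asserts nothing about HC and is count-neutral.

## References
* [MumfordAV1970] D. Mumford, *Abelian Varieties* (1970), §13 (p. 123), §7 Thm. 4 (p. 72), §16, §23.
* [MumfordFogartyKirwan1994] D. Mumford, J. Fogarty, F. Kirwan, *GIT*, 3rd ed. (1994), Ch. 6 §2 Prop. 6.13 (iii) (p. 123), Lemma 6.12 (p. 122).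
* [GortzWedhorn2023] U. Görtz, T. Wedhorn, *Algebraic Geometry II* (2023), Prop. 27.187, Cor. 27.63, Cor. 24.63 (p. 404).
* [GortzWedhorn2020] U. Görtz, T. Wedhorn, *Algebraic Geometry I*, 2nd ed. (2020), Section (4.7) (4.7.1) (p. 108), Section (4.8), Prop. 4.16 (p. 101).
* [BLRNeronModels1990] S. Bosch, W. Lütkebohmert, M. Raynaud, *Néron Models* (1990), §7.3 Lemma 2 (b) (p. 180).
* [SGA1] A. Grothendieck, *SGA 1*, Exp. I Thm. 6.1.
-/

set_option autoImplicit false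

noncomputable section

-- `TopCat.Presheaf`/`Scheme.Modules` are not reducible (as in ★ `AbelianSchemeKOfL`).
set_option backward.isDefEq.respectTransparency false

open CategoryTheory CategoryTheory.Limits AlgebraicGeometry MonoidalCategory CartesianMonoidalCategory IsLocalRing

open scoped MonObj

namespace Literature.AlgebraicGeometry.AbelianSchemes

open Literature.AlgebraicGeometry.Motives Literature.AlgebraicGeometry.Motives.AbelianVariety Literature.AlgebraicGeometry.Limits
  Literature.AlgebraicGeometry.AbelianVarieties Literature.AlgebraicGeometry.Modules Literature.AlgebraicGeometry.Morphisms

namespace AbelianSchemeOver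

variable {R : Type} [CommRing R] (A : AbelianSchemeOver (Spec (.of R)))

/-! ## §1 An integer invertible in `R` is a unit of every `Γ(X, 𝒪_X)`, `X → Spec R`, and non-zero in every field over `R` -/

section Units

/-- **`n ∈ R^× ⇒ n ∈ Γ(X, 𝒪_X)^×` for every `X → Spec R`** (through `R ≅ Γ(Spec R, 𝒪) → Γ(X, 𝒪_X)`; replaces ★ `isUnit_natCast_Γ`, where
the unit came from `ℚ ⊆ R`). [cite: GortzWedhorn2020, Section (4.7), (4.7.1) (p. 108)] -/
theorem isUnit_natCast_Γ_of_isUnit (X : Over (Spec (.of R))) {n : ℕ} (hn : IsUnit ((n : ℕ) : R)) : IsUnit (n : Γ(X.left, ⊤)) := by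
  have h := hn.map ((Scheme.ΓSpecIso (CommRingCat.of R)).inv ≫ X.hom.appTop).hom
  rwa [map_natCast] at h

/-- **`n ∈ R^× ⇒ n ≠ 0` in every field `K` receiving a morphism `Spec K → Spec R`** (`R → K` is a ring map into a non-trivial ring).
[cite: GortzWedhorn2020, Section (4.7), (4.7.1) (p. 108)] -/
theorem natCast_ne_zero_of_isUnit_specMap {K : Type} [Field K] (t : Spec (.of K) ⟶ Spec (.of R)) {n : ℕ}
    (hn : IsUnit ((n : ℕ) : R)) : (n : K) ≠ 0 := by
  have h := hn.map (Spec.preimage t).hom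
  rw [map_natCast] at h
  exact h.ne_zero

/-- A field-valued point of `Spec R` through a given point `x` (its residue field: Mathlib `Spec.map_residueFieldIso_inv_eq_fromSpecResidueField`,
`Scheme.fromSpecResidueField_apply`) — ★ `exists_fieldPoint_charZero` without the characteristic. [cite: GortzWedhorn2020, Section (4.8)] -/
theorem exists_fieldPoint_residueField (x : Spec (.of R)) :
    ∃ (K : Type) (_ : Field K) (t : Spec (.of K) ⟶ Spec (.of R)), t (IsLocalRing.closedPoint K) = x := by
  refine ⟨x.asIdeal.ResidueField, inferInstance, Spec.map (CommRingCat.ofHom (algebraMap R x.asIdeal.ResidueField)), ?_⟩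
  haveI : Subsingleton ↥(Spec (CommRingCat.of x.asIdeal.ResidueField)) :=
    inferInstanceAs (Subsingleton (PrimeSpectrum x.asIdeal.ResidueField))
  have h1 := Scheme.Spec.map_residueFieldIso_inv_eq_fromSpecResidueField (.of R) x
  have h2 : IsLocalRing.closedPoint x.asIdeal.ResidueField =
      Spec.map (Scheme.Spec.residueFieldIso (.of R) x).inv (IsLocalRing.closedPoint _) := Subsingleton.elim _ _
  rw [h2, ← Scheme.Hom.comp_apply, h1, Scheme.fromSpecResidueField_apply]

end Units

/-! ## §2 A finite closed subscheme `i : Z ↪ A` with `i ^ n = 1`, `n ∈ R^×`, is unramified over `Spec R`; étale once flat -/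

section Unramified

variable {Z : Over (Spec (.of R))} (i : Z ⟶ A.X) [IsClosedImmersion i.left] {n : ℕ} (hn : IsUnit ((n : ℕ) : R)) (hin : i ^ n = 1)

omit [IsClosedImmersion i.left] in
/-- **Powers survive base change to a field point**: `(i_t) ^ m = (i ^ m)_t` in the fibre abelian variety `A_t` (the cartesian-monoidal
`Over.pullback t` is multiplicative on points: Mathlib `Functor.map_mul` / `Functor.map_one`). [cite: GortzWedhorn2020, Prop. 4.16 (p. 101) and Section (4.8)] -/
theorem embFibre_pow {K : Type} [Field K] (t : Spec (.of K) ⟶ Spec (.of R)) (m : ℕ) :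
    A.embFibre i t ^ m = (Over.pullback t).map (i ^ m) := by
  induction m with
  | zero => rw [pow_zero, pow_zero, Functor.map_one]
  | succ m ih => rw [pow_succ, pow_succ, Functor.map_mul, ih]

omit [IsClosedImmersion i.left] in
include hin in
/-- **`i ^ n = 1` survives base change to a field point**: `(i_t) ^ n = 1` in the fibre abelian variety `A_t` (`embFibre_pow`,
Mathlib `Functor.map_one`). [cite: GortzWedhorn2020, Prop. 4.16 (p. 101) and Section (4.8)] -/
theorem embFibre_pow_eq_one {K : Type} [Field K] (t : Spec (.of K) ⟶ Spec (.of R)) : A.embFibre i t ^ n = 1 := by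
  rw [A.embFibre_pow i t n, hin, Functor.map_one]

include hn hin in
/-- **The fibre `Z_t → Spec K` at every field point is ÉTALE**: `Z_t ↪ A_t` is a closed subscheme killed by `n` (`embFibre_pow_eq_one`) and
`n ≠ 0` in `K` (`natCast_ne_zero_of_isUnit_specMap`), so ★ U2 `etale_hom_of_pow_eq_one` applies — the characteristic-free form of ★
`etale_pullback_obj_hom`. [cite: GortzWedhorn2023, Prop. 27.187 and Cor. 27.63] [cite: MumfordAV1970, §7 Thm. 4 (p. 72)] -/
theorem etale_pullback_obj_hom_of_pow_eq_one {K : Type} [Field K] (t : Spec (.of K) ⟶ Spec (.of R)) :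
    Etale ((Over.pullback t).obj Z).hom := by
  haveI : IsClosedImmersion (A.embFibre i t).left :=
    MorphismProperty.of_isPullback (P := @IsClosedImmersion) (isPullback_pullback_map_left t i).flip inferInstance
  have hord : ((n : ℤ) : K) ≠ 0 := by exact_mod_cast natCast_ne_zero_of_isUnit_specMap t hn
  have hpow : A.embFibre i t ^ (n : ℤ) = 1 := by rw [zpow_natCast]; exact A.embFibre_pow_eq_one i hin t
  exact etale_hom_of_pow_eq_one (A.embFibre i t) (n : ℤ) hord hpow

include hn hin in
/-- **A closed subscheme `i : Z ↪ A`, locally of finite type over `Spec R`, with `i ^ n = 1` and `n ∈ R^×` is FORMALLY UNRAMIFIED over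
`Spec R`** (one field point per `s ∈ Spec R`, `etale_pullback_obj_hom_of_pow_eq_one`, ★ `formallyUnramified_left_of_forall_exists_fieldPoint`)
— ★ `formallyUnramified_hom_of_subgroup` off `ℚ`. [cite: GortzWedhorn2023, Prop. 27.187 and Cor. 27.63] [cite: MumfordAV1970, §7 Thm. 4 (p. 72)] -/
theorem formallyUnramified_hom_of_pow_eq_one_of_isUnit [LocallyOfFiniteType Z.hom] : FormallyUnramified Z.hom := by
  have hlft : LocallyOfFiniteType (toUnit Z).left := by rw [Over.toUnit_left]; infer_instance
  have key : FormallyUnramified (toUnit Z).left := by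
    refine formallyUnramified_left_of_forall_exists_fieldPoint (toUnit Z) fun s => ?_
    obtain ⟨K, _, t, ht⟩ := exists_fieldPoint_residueField (R := R) s
    refine ⟨K, inferInstance, t, ht, ?_⟩
    haveI : Etale ((Over.pullback t).obj Z).hom := A.etale_pullback_obj_hom_of_pow_eq_one i hn hin t
    haveI : FormallyUnramified (((Over.pullback t).map (toUnit Z)).left ≫ ((Over.pullback t).obj (𝟙_ _)).hom) := by
      rw [Over.w]
      exact (Etale.iff_flat_and_formallyUnramified.mp inferInstance).2.1
    exact FormallyUnramified.of_comp _ ((Over.pullback t).obj (𝟙_ (Over (Spec (.of R))))).hom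
  rwa [Over.toUnit_left] at key

include hn hin in
/-- **… and ÉTALE over `Spec R` as soon as it is FLAT** (`R` Noetherian, `Z → Spec R` finite: unramified + flat + locally of finite
presentation, Mathlib `Etale.of_formallyUnramified_of_flat`). [cite: GortzWedhorn2023, Prop. 27.187 and Cor. 27.63]
[cite: MumfordFogartyKirwan1994, Ch. 6 §2 Prop. 6.13 (iii) (p. 123)] -/
theorem etale_hom_of_pow_eq_one_of_isUnit_of_flat [IsNoetherianRing R] [IsFinite Z.hom] [Flat Z.hom] : Etale Z.hom := by
  haveI := A.formallyUnramified_hom_of_pow_eq_one_of_isUnit i hn hin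
  haveI : LocallyOfFinitePresentation Z.hom := LocallyOfFinitePresentation.iff_locallyOfFiniteType.mpr inferInstance
  exact Etale.of_formallyUnramified_of_flat _

end Unramified

/-! ## §3 The core of road (T) with `n ∈ R^×`: infinitesimal neighbourhoods in an `n`-torsion `G → A` of points of `Z` factor through `Z` -/

section Core

variable [IsNoetherianRing R] {L : A.left.Modules} (hL : HasRank L 1)
  (hε : CechPic.pullback A.unitSection (detClass (HasRank.isFiniteLocallyFree' hL)) = 1)
  {Z : Over (Spec (.of R))} (i : Z ⟶ A.X)
  (hZ : ∀ (T : Over (Spec (.of R))) (u : T ⟶ A.X), (∃ v : T ⟶ Z, v ≫ i = u) ↔ A.MemKOfL L u)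
  {G : Over (Spec (.of R))} (q : G ⟶ A.X) [Mono q] {n : ℕ} (hnR : IsUnit ((n : ℕ) : R)) (hq : q ^ n = 1) (j : Z ⟶ G)
  [IsClosedImmersion j.left] (hj : j ≫ q = i)

include hL hε hZ hnR hq hj in
/-- **THE CORE of road (T), characteristic-free: `j : Z ↪ G` IS AN OPEN IMMERSION.**  For `q : G → A` over `Spec R` with `q ^ n = 1`,
`n` a UNIT of `R`, `G` locally Noetherian, and a closed immersion `j : Z → G` with `j ≫ q = i` the representing immersion of `K(L)`: every
infinitesimal neighbourhood `Spec(𝒪_{G,t}/𝔪^{k+1}) → G` of a point `t` of `j(Z)` factors through `j` — the proof of ★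
`exists_infinitesimal_fac_of_pow_eq_one` word for word (theorem of the square ⇒ `n`-torsion class; reduction in `K(L)` ⇒ trivial on the
closed fibre; ★ Stein ⇒ units lift; TORSION RIGIDITY ★ (T2) with `n ∈ Γ(A ×_R T, 𝒪)^×` now from `isUnit_natCast_Γ_of_isUnit`;
representability ★ ⇒ factorisation) — so `j` is an open immersion by the infinitesimal criterion ★ (T5)
`IsClosedImmersion.isOpenImmersion_of_forall_infinitesimal_factors`. [cite: MumfordAV1970, §13 (p. 123)]
[cite: MumfordFogartyKirwan1994, Ch. 6 §2 Prop. 6.13 (iii) (p. 123)] [cite: GortzWedhorn2023, Cor. 24.63 (p. 404)] [cite: SGA1, Exp. I Thm. 6.1] -/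
theorem isOpenImmersion_left_of_pow_eq_one_of_isUnit [IsLocallyNoetherian G.left] : IsOpenImmersion j.left := by
  refine IsClosedImmersion.isOpenImmersion_of_forall_infinitesimal_factors j.left fun t ht k => ?_
  obtain ⟨z, rfl⟩ := ht
  -- notation: the Artin local ring `B = 𝒪/𝔪^{k+1}`, its residue map `ρ : B ↠ κ(t)`, the point `g : Spec B → G`
  set O := G.left.presheaf.stalk (j.left.base z) with hO
  haveI : IsLocalRing (↑O ⧸ maximalIdeal ↑O ^ (k + 1)) := isLocalRing_stalk_quot (G := G) (j.left.base z) k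
  have hle : maximalIdeal ↑O ^ (k + 1) ≤ RingHom.ker (IsLocalRing.residue ↑O) := by
    rw [IsLocalRing.ker_residue]; exact Ideal.pow_le_self (Nat.succ_ne_zero k)
  let ρ : (↑O ⧸ maximalIdeal ↑O ^ (k + 1)) →+* G.left.residueField (j.left.base z) :=
    Ideal.Quotient.lift _ (IsLocalRing.residue ↑O) fun a ha => hle ha
  have hρ : Function.Surjective ρ := fun x => by
    obtain ⟨a, rfl⟩ := IsLocalRing.residue_surjective x
    exact ⟨Ideal.Quotient.mk _ a, Ideal.Quotient.lift_mk _ _ _⟩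
  have hρmk : (CommRingCat.ofHom (Ideal.Quotient.mk (maximalIdeal ↑O ^ (k + 1)))) ≫ CommRingCat.ofHom ρ =
      G.left.residue (j.left.base z) := by
    ext a; rfl
  set g : Spec (.of (↑O ⧸ maximalIdeal ↑O ^ (k + 1))) ⟶ G.left :=
    Spec.map (CommRingCat.ofHom (Ideal.Quotient.mk (maximalIdeal ↑O ^ (k + 1)))) ≫ G.left.fromSpecStalk (j.left.base z) with hg
  have hgρ : Spec.map (CommRingCat.ofHom ρ) ≫ g = G.left.fromSpecResidueField (j.left.base z) := by
    rw [hg, ← Category.assoc, ← Spec.map_comp, hρmk]; rfl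
  -- the Artin point `u : T → A` and its reduction `τ : T₀ → T`
  let T : Over (Spec (.of R)) := Over.mk (g ≫ G.hom)
  let g' : T ⟶ G := Over.homMk g rfl
  let u : T ⟶ A.X := g' ≫ q
  let T₀ : Over (Spec (.of R)) := Over.mk (G.left.fromSpecResidueField (j.left.base z) ≫ G.hom)
  let τ : T₀ ⟶ T := Over.homMk (Spec.map (CommRingCat.ofHom ρ)) (by
    change Spec.map (CommRingCat.ofHom ρ) ≫ g ≫ G.hom = G.left.fromSpecResidueField (j.left.base z) ≫ G.hom
    rw [← Category.assoc, hgρ])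
  -- `u ^ n = 1`, so `a := (1 × u)^*[Λ]c` is `n`-torsion
  have hun : u ^ n = 1 := by
    change (g' ≫ q) ^ n = 1
    rw [← MonObj.comp_pow, hq, MonObj.comp_one]
  have hpow : (CechPic.pullback (A.X ◁ u).left (A.mumfordClass (detClass (HasRank.isFiniteLocallyFree' hL)))) ^ n = 1 := by
    rw [← A.pullback_whiskerLeft_pow_mumfordClass _ hε u n, hun, A.pullback_whiskerLeft_mumfordClass_eq_one_iff,
      A.pullback_whiskerLeft_one_mul, A.pullback_snd_one _ hε, mul_one]
  -- the reduction `τ ≫ u` is the point `z ∈ Z = K(L)`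
  obtain ⟨v₀, hv₀⟩ := IsClosedImmersion.exists_fromSpecResidueField_fac j.left z
  have hmem₀ : A.MemKOfL L (τ ≫ u) := by
    refine (hZ T₀ (τ ≫ u)).mp ⟨Over.homMk v₀ ?_, ?_⟩
    · change v₀ ≫ Z.hom = G.left.fromSpecResidueField (j.left.base z) ≫ G.hom
      rw [← Over.w j, ← Category.assoc, hv₀]
    · ext
      change v₀ ≫ i.left = Spec.map (CommRingCat.ofHom ρ) ≫ g ≫ q.left
      rw [← hj, Over.comp_left, ← Category.assoc, hv₀, ← Category.assoc, hgρ]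
  have hpull : CechPic.pullback (A.X ◁ τ).left
      (CechPic.pullback (A.X ◁ u).left (A.mumfordClass (detClass (HasRank.isFiniteLocallyFree' hL)))) = 1 := by
    rw [← pullback_comp_left, ← MonoidalCategory.whiskerLeft_comp]
    exact (A.memKOfL_iff_mumfordClass hL _).mp hmem₀
  -- the closed fibre `A_{κ(t)} ↪ A_T`: a surjective closed immersion along which units lift; `n` is a unit
  haveI : IsClosedImmersion τ.left := by
    change IsClosedImmersion (Spec.map (CommRingCat.ofHom ρ))
    exact IsClosedImmersion.spec_of_surjective _ hρ
  haveI : Surjective τ.left := by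
    change Surjective (Spec.map (CommRingCat.ofHom ρ))
    haveI : Subsingleton ↥(Spec (CommRingCat.of (↑O ⧸ maximalIdeal ↑O ^ (k + 1)))) :=
      subsingleton_spec_stalk_quot (G := G) (j.left.base z) k
    exact ⟨fun x => ⟨closedPoint _, Subsingleton.elim _ _⟩⟩
  haveI : IsClosedImmersion (A.X ◁ τ).left :=
    MorphismProperty.of_isPullback (P := @IsClosedImmersion) (SubalgApprox.isPullback_whiskerLeft_left A.X τ).flip inferInstance
  haveI : Surjective (A.X ◁ τ).left := inferInstance
  have hlift : ∀ w : Γ((A.X ⊗ T₀).left, ⊤), IsUnit w → ∃ v : Γ((A.X ⊗ T).left, ⊤), IsUnit v ∧ (A.X ◁ τ).left.appTop v = w :=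
    A.exists_isUnit_appTop_whiskerLeft τ
      (fun w hw => exists_isUnit_appTop_specMap_of_surjective ρ hρ w hw)
  have hnu : IsUnit ((n : ℕ) : Γ((A.X ⊗ T).left, ⊤)) := isUnit_natCast_Γ_of_isUnit (A.X ⊗ T) hnR
  -- TORSION RIGIDITY (T2): `a = 1`, so `u ∈ K(L)(T)` and `T → G` factors through `Z`
  have ha : CechPic.pullback (A.X ◁ u).left (A.mumfordClass (detClass (HasRank.isFiniteLocallyFree' hL))) = 1 :=
    CechPic.eq_one_of_pow_eq_one_of_pullback_eq_one (A.X ◁ τ).left hlift hnu hpow hpull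
  obtain ⟨v, hv⟩ := (hZ T u).mpr ((A.memKOfL_iff_mumfordClass hL u).mpr ha)
  refine ⟨v.left, ?_⟩
  have hvj : v ≫ j = g' := by
    rw [← cancel_mono q, Category.assoc, hj, hv]
  change v.left ≫ j.left = g'.left
  rw [← Over.comp_left, hvj]

end Core

/-! ## §4 `K(L)` is flat, hence finite étale, over a Noetherian affine base on which an exponent killing it is invertible -/

section KOfL

variable [IsNoetherianRing R] {L : A.left.Modules} (hL : HasRank L 1)
  (hε : CechPic.pullback A.unitSection (detClass (HasRank.isFiniteLocallyFree' hL)) = 1)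
  {n : ℕ} (hnR : IsUnit ((n : ℕ) : R)) (hkill : ∀ (T : Over (Spec (.of R))) (u : T ⟶ A.X), A.MemKOfL L u → u ^ n = 1)

include hL hε hnR hkill in
/-- **`K(L) → Spec R` IS FLAT** when `K(L) ⊆ A[n]` for an `n` invertible in `R`: for a closed immersion `i : Z ↪ A`, finite over the
Noetherian affine base and representing `K(L)`, `Z → Spec R` is flat — `i ^ n = 1` (`hkill` at `u = i`), `j : Z ↪ A[n]` (★ (T4)), all
infinitesimal neighbourhoods in `A[n]` of points of `Z` factor through `j`, so `j` is an OPEN immersion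
(`isOpenImmersion_left_of_pow_eq_one_of_isUnit`) into `A[n]`, which is ÉTALE over `Spec R` because `n ≠ 0` in every residue field of `Spec R` (★
`etale_fst_unit_pow_id`, ★ `natCast_residueField_ne_zero`-type plumbing). [cite: MumfordAV1970, §13 (p. 123)]
[cite: MumfordFogartyKirwan1994, Ch. 6 §2 Prop. 6.13 (iii) (p. 123)] [cite: BLRNeronModels1990, §7.3 Lemma 2 (b) (p. 180)] [cite: SGA1, Exp. I Thm. 6.1] -/
theorem flat_hom_of_iff_memKOfL_of_isUnit {Z : Over (Spec (.of R))} (i : Z ⟶ A.X) [IsClosedImmersion i.left] [IsFinite Z.hom]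
    (hZ : ∀ (T : Over (Spec (.of R))) (u : T ⟶ A.X), (∃ v : T ⟶ Z, v ≫ i = u) ↔ A.MemKOfL L u) : Flat Z.hom := by
  have hin : i ^ n = 1 := hkill Z i ((hZ Z i).mp ⟨𝟙 Z, Category.id_comp i⟩)
  -- `n ≠ 0` in every residue field of `Spec R`
  have hres : ∀ s : ↥(Spec (.of R)), (n : (Spec (.of R)).residueField s) ≠ 0 := fun s => by
    have h := (isUnit_natCast_Γ_of_isUnit (Over.mk (𝟙 (Spec (.of R)))) hnR).map ((Spec (.of R)).evaluation ⊤ s trivial).hom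
    rw [map_natCast] at h
    exact h.ne_zero
  -- `G := A[n] → Spec R`, étale; `q : G → A` over `Spec R`, a monomorphism with `q ^ n = 1`
  have hGet := A.etale_fst_unit_pow_id hres
  let G : Over (Spec (.of R)) :=
    Over.mk (pullback.fst (η[A.X] : 𝟙_ _ ⟶ A.X).left ((((𝟙 A.X : A.X ⟶ A.X) ^ n) : A.X ⟶ A.X).left))
  let q : G ⟶ A.X := Over.homMk (pullback.snd _ _) (A.pullback_snd_unit_pow_id_comp_hom n)
  haveI : IsClosedImmersion (η[A.X] : 𝟙_ _ ⟶ A.X).left := A.isClosedImmersion_unit_left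
  haveI : Mono q.left := by
    change Mono (pullback.snd (η[A.X] : 𝟙_ _ ⟶ A.X).left ((((𝟙 A.X : A.X ⟶ A.X) ^ n) : A.X ⟶ A.X).left))
    infer_instance
  haveI : Mono q := Over.mono_of_mono_left q
  have hq : q ^ n = 1 := Over.OverMorphism.ext (by
    have h1 : q ^ n = q ≫ ((𝟙 A.X : A.X ⟶ A.X) ^ n) := by rw [MonObj.comp_pow, Category.comp_id]
    rw [h1, Hom.one_def, Over.comp_left, Over.comp_left, Over.toUnit_left]
    exact (pullback.condition).symm)
  -- `j : Z → G` over `Spec R`, a closed immersion with `j ≫ q = i`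
  let j : Z ⟶ G := Over.homMk (pullback.lift Z.hom i.left (A.left_comp_pow_id_left_eq i hin).symm)
    (A.pullbackLift_unit_pow_id_fst i hin)
  have hj : j ≫ q = i := Over.OverMorphism.ext (A.pullbackLift_unit_pow_id_snd i hin)
  haveI : IsClosedImmersion j.left := A.isClosedImmersion_pullbackLift_unit_pow_id i hin
  haveI : IsLocallyNoetherian A.X.left := A.isLocallyNoetherian_left
  haveI : IsLocallyNoetherian G.left :=
    inferInstanceAs (IsLocallyNoetherian
      (pullback (η[A.X] : 𝟙_ _ ⟶ A.X).left ((((𝟙 A.X : A.X ⟶ A.X) ^ n) : A.X ⟶ A.X).left)))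
  -- the infinitesimal criterion: `j` is an open immersion into the étale `G`
  haveI : IsOpenImmersion j.left := A.isOpenImmersion_left_of_pow_eq_one_of_isUnit hL hε i hZ q hnR hq j hj
  haveI : Flat G.hom := by
    haveI : Etale G.hom := hGet
    infer_instance
  rw [← Over.w j]
  infer_instance

include hε hnR hkill in
/-- **`K(L)` IS FINITE ÉTALE OVER A NOETHERIAN AFFINE BASE ON WHICH AN EXPONENT KILLING IT IS INVERTIBLE** — ★ `exists_kOfL_etale` OFF `ℚ`:
for every abelian scheme `A` over a Noetherian ring `R` (arbitrary characteristic; neither a domain nor reduced), every rank-one `L` on `A`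
rigidified along the identity section and fibrewise of the class of an ample divisor, and every `n ∈ R^×` with `u ^ n = 1` for all
`u ∈ K(L)(T)`, `K(L)` is represented by a closed subgroup scheme `Z ↪ A` FINITE and ÉTALE over `Spec R`, contained in `A[n]` (★
`exists_isClosedImmersion_isFinite_iff_memKOfL_of_isNoetherianRing`; `flat_hom_of_iff_memKOfL_of_isUnit`;
`etale_hom_of_pow_eq_one_of_isUnit_of_flat`). [cite: MumfordAV1970, §13 (p. 123) and §23] [cite: MumfordFogartyKirwan1994, Ch. 6 §2 Prop. 6.13 (iii) (p. 123)]
[cite: GortzWedhorn2023, Prop. 27.187 and Cor. 27.63] -/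
theorem exists_kOfL_etale_of_isUnit
    (hΘ : ∀ ⦃Ω : Type⦄ [Field Ω] [IsAlgClosed Ω] (s : Spec (.of Ω) ⟶ Spec (.of R)),
      ∃ Θ : CartierDivisor (A.fibre s).toAbelianVariety.X.left, Θ.IsAmple ∧
        CechPic.pullback (X := (A.fibre s).toAbelianVariety.X.left) (pullback.fst A.X.hom s)
          (detClass (HasRank.isFiniteLocallyFree' hL)) = Θ.cechClass) :
    ∃ (Z : Over (Spec (.of R))) (i : Z ⟶ A.X) (_ : IsClosedImmersion i.left) (_ : IsFinite Z.hom) (_ : Etale Z.hom),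
      i ^ n = 1 ∧ ∀ (T : Over (Spec (.of R))) (u : T ⟶ A.X), (∃ v : T ⟶ Z, v ≫ i = u) ↔ A.MemKOfL L u := by
  obtain ⟨Z, i, hci, hfin, hZ⟩ := A.exists_isClosedImmersion_isFinite_iff_memKOfL_of_isNoetherianRing hL hε hΘ
  have hin : i ^ n = 1 := hkill Z i ((hZ Z i).mp ⟨𝟙 Z, Category.id_comp i⟩)
  haveI : Flat Z.hom := A.flat_hom_of_iff_memKOfL_of_isUnit hL hε hnR hkill i hZ
  exact ⟨Z, i, hci, hfin, A.etale_hom_of_pow_eq_one_of_isUnit_of_flat i hnR hin, hin, hZ⟩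

end KOfL

end AbelianSchemeOver

end Literature.AlgebraicGeometry.AbelianSchemes

end
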